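import Mathlib
import Literature.NumberTheory.LFunctions.Zhang2022.Section12U030Smoothing
import Literature.NumberTheory.LFunctions.Zhang2022.Section12U030Contour
import Literature.NumberTheory.LFunctions.Zhang2022.Section12U030ResidueTwo
import Literature.NumberTheory.LFunctions.Zhang2022.Section12U030Bookkeeping
import Literature.NumberTheory.LFunctions.Zhang2022.Section8Lemma84
import Literature.NumberTheory.LFunctions.Zhang2022.Section12U024Mellin
import Literature.NumberTheory.LFunctions.Zhang2022.SkeletonLemma83Rel
import HarnessLib

/-!
# Zhang (2022) §12 u030 (relative form) from Lemma 8.3 (relative form): the core of the RT-02 node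
# `hTop25Ex` of the ZHANG-L discharge tree

Topic `Literature/NumberTheory/LFunctions/Zhang2022` (Landau–Siegel audit tree; verdict-neutral).
Y. Zhang, *Discrete mean estimates and the Landau–Siegel zero*, arXiv:2211.02515v1 (2022)
[Zhang2022LandauSiegel] — **an unrefereed manuscript under adjudication**; nothing here asserts or
denies its Theorems 1–2. ZHANG-L lane WP12 (WP12-PLAN §3 C-U030).

The typed node `Typed.Sec12B.U030` (§12 p.70, proof of Lemma 12.3: "Assume `|w| = α`. In a way similar
to the proof of Lemma 12.1 [12.2], we deduce that `Σ_{l<P″₂/dr} χ(l)ξ_j(l;d,r)l^{−(1−β₆+w)} =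
L′(1,χ)Π(d,r)·(2πi)⁻¹∮_{|s|=5α}(…)(P″₂/dr)^s ds/s + O(𝓛⁻¹⁵)`") asks for an ABSOLUTE error `O(𝓛⁻¹⁵)`;
what the manuscript's own route (smooth by `g` (4.2)–(4.3), Mellin (4.1), move the contour as in
Lemma 8.4 using Lemma 8.3 (ii)–(iii) and Lemma 5.8) delivers from the RELATIVE Lemma 8.3 of the tree
(`Skeleton.Lemma83Rel`, (iii′) with the weight `Π̂ = ∏_{q∣dr}(1−q⁻¹)⁻¹`) is the RELATIVE bound
`O(𝓛⁻¹⁵Π̂²)` — exactly as for Lemma 8.4 (`Lemma84Rel`). THIS FILE proves that relative form: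

* `u030Rel_of_lemma83Rel` — `Lemma83Rel c′ →` for all large `D`, under (A), for `j ≤ 3`,
  `P″₁ < dr < P₂`, `|w| = α`:
  `‖innerSumLow c′ χ j d r w − L′(1,χ)Π(d,r)·circ030 c′ D j d r w‖ ≤ C𝓛⁻¹⁵(∏_{q∣dr}(1−q⁻¹)⁻¹)²`.

Assembly of: the smoothing step `Typed.Sec12B.innerSumLow_sub_smooth_le` (Λ = 𝓛¹⁰⁰), the contour core
`Lemma84.smoothedSeries_sub_residues_le` (β_μ := β₆ − i·Im w, θ := −Re w, Y = P″₂/dr, T′ = D), the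
residue comparisons `Lemma84.norm_resOne_sub_model_le` / `norm_resTwo_sub_model_le`, the residue
identity `Typed.Sec12B.U031_holds`, and the bookkeeping `Lemma84.remainder_le` / `resOne_le` /
`resTwo_le`; constants and thresholds as in the tree's `Lemma84.lemma84Rel_of_lemma83Rel`.

## References

* Y. Zhang, arXiv:2211.02515v1 (2022), §12 pp.69–70 (proof of Lemma 12.3, u024–u031); §8 Lemmas
  8.3–8.4; §5 Lemma 5.8; §4 (4.1)–(4.3). [cite: Zhang2022LandauSiegel, §12 p.70; §8 Lemma 8.4]
* H. L. Montgomery, R. C. Vaughan, *Multiplicative Number Theory I* (CUP 2007), §6.2, Thm 11.4.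
  [cite: MontgomeryVaughan2007, §6.2]
-/

noncomputable section

open Complex Real MeasureTheory

namespace Literature.NumberTheory.LFunctions.Zhang2022.Typed.Sec12B

open Literature.NumberTheory.LFunctions.Zhang2022.Skeleton
open Literature.NumberTheory.LFunctions.Zhang2022.GaussWeight
open Literature.NumberTheory.LFunctions.Zhang2022.Lemma84

/-- A natural threshold for `log D ≥ M`. [cite: Zhang2022LandauSiegel, §2 ("D large")] -/
private theorem exists_nat_le_log' (M : ℝ) : ∃ D₀ : ℕ, ∀ D : ℕ, D₀ ≤ D → M ≤ Real.log D := by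
  obtain ⟨N, hN⟩ := exists_nat_gt (Real.exp M)
  refine ⟨N, fun D hD => ?_⟩
  have hD' : Real.exp M < D := lt_of_lt_of_le hN (by exact_mod_cast hD)
  have hDpos : (0 : ℝ) < D := lt_trans (Real.exp_pos M) hD'
  rw [Real.le_log_iff_exp_le hDpos]
  exact hD'.le

/-- The two residues' model terms add up to `L′(1,χ)Π·circ030`: with `s = w − β₆ ≠ 0`,
`(s+β_a)(s+β_b)/s + β_aβ_b·Y^{−s}/(−s) = s + β_a + β_b + β_aβ_b(Y^{−s} − 1)/(−s)`.
[cite: Zhang2022LandauSiegel, §12 p.70 (u031, "by direct calculation")] -/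
theorem model_identity {s βa βb X : ℂ} (hs : s ≠ 0) :
    (s + βa) * (s + βb) / s + βa * βb * (X / (-s)) = s + βa + βb + βa * βb * ((X - 1) / (-s)) := by
  have hs' : -s ≠ 0 := neg_ne_zero.mpr hs
  field_simp
  ring

/-- `P₂ = P^{1/2}T⁻¹⁰ ≤ PT⁻²` (so the range `dr < P₂` of u030 lies in Lemma 8.3's range `dr < PT⁻²`).
[cite: Zhang2022LandauSiegel, §12 p.70; §8 Lemma 8.3] -/
theorem P2_le_bigP_div (D : ℕ) : Skeleton.P2 D ≤ bigP D / bigT D ^ 2 := by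
  have hP : 1 ≤ bigP D := by
    rw [bigP]
    refine Real.one_le_exp (pow_nonneg ?_ 9)
    rw [ell]; exact Real.log_natCast_nonneg D
  have hT : 1 ≤ bigT D := by
    rw [bigT]
    exact Real.one_le_exp (Real.rpow_nonneg (by rw [ell]; exact Real.log_natCast_nonneg D) _)
  have hT0 : 0 < bigT D := by linarith
  rw [Skeleton.P2, div_le_div_iff₀ (pow_pos hT0 10) (pow_pos hT0 2)]
  have h1 : bigP D ^ (0.5 : ℝ) ≤ bigP D := by
    calc bigP D ^ (0.5 : ℝ) ≤ bigP D ^ (1 : ℝ) := Real.rpow_le_rpow_of_exponent_le hP (by norm_num)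
      _ = bigP D := Real.rpow_one _
  have h2 : bigT D ^ 2 ≤ bigT D ^ 10 := pow_le_pow_right₀ hT (by norm_num)
  exact mul_le_mul h1 h2 (pow_nonneg hT0.le 2) (by linarith)

set_option maxHeartbeats 1600000 in
/-- **u030 in the relative form, from Lemma 8.3 in the relative form** (WP12-PLAN C-U030; the core of
the RT-02 node `hTop25Ex`). For every `c′`: `Lemma83Rel c′ →` there is `C` such that for all large `D`,
every real primitive `χ (mod D)` with (A), `j ∈ {1,2,3}`, `d, r ≥ 1` with `P″₁ < dr < P₂` and `|w| = α`,
`‖Σ_{l<P″₂/dr} χ(l)ξ_j(l;d,r)l^{−(1−β₆+w)} − L′(1,χ)Π(d,r)·(2πi)⁻¹∮_{|s|=5α}(…)(P″₂/dr)^s ds/s‖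
 ≤ C𝓛⁻¹⁵·(∏_{q∣dr}(1 − q⁻¹)⁻¹)²`.
The manuscript's printed u030 (absolute `O(𝓛⁻¹⁵)`) would need the absolute Lemma 8.3 (iii).
[cite: Zhang2022LandauSiegel, §12 p.70 (proof of Lemma 12.3); §8 Lemmas 8.3–8.4]
[cite: MontgomeryVaughan2007, §6.2] -/
theorem u030Rel_of_lemma83Rel (c' : ℝ) (h83 : Lemma83Rel c') :
    ∃ C : ℝ, ForAllLarge fun D _ χ => AssumptionA D χ →
      ∀ j ∈ ({1, 2, 3} : Finset ℕ), ∀ d r : ℕ, 1 ≤ d → 1 ≤ r →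
        P1pp D < ((d * r : ℕ) : ℝ) → ((d * r : ℕ) : ℝ) < Skeleton.P2 D → ∀ w : ℂ, ‖w‖ = alpha D →
          ‖innerSumLow c' χ j d r w - deriv χ.LFunction 1 * PiW χ d r * circ030 c' D j d r w‖ ≤
            C * (ell D ^ 15)⁻¹ * (∏ q ∈ (d * r).primeFactors, (1 - (q : ℝ)⁻¹)⁻¹) ^ 2 := by
  obtain ⟨C₈₃, D83, h83⟩ := h83
  obtain ⟨c, hc, hc4, Cinv, hCinv, Kρ, hKρ, D₁, hpack⟩ := exceptional_package
  obtain ⟨L₅₇, h57⟩ := Lemma57.lemma_5_7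
  obtain ⟨Csm, Dsm, hsm⟩ := innerSumLow_sub_smooth_le c'
  obtain ⟨D31, h31⟩ := U031_holds c'
  -- constants
  set C : ℝ := |C₈₃| with hCdef
  have hC0 : 0 ≤ C := abs_nonneg _
  set K₈ : ℝ := 7 + 15 * |c'| with hK₈
  have hK₈1 : 1 ≤ K₈ := by rw [hK₈]; linarith [abs_nonneg c']
  have hK₈0 : 0 ≤ K₈ := by linarith
  set C₅ : ℝ := 1 + 16 * Real.exp (9 / 2) * π ^ 2 * K₈ ^ 2 with hC₅
  have hC₅0 : 0 ≤ C₅ := by positivity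
  set ℓ₀ : ℝ := Real.exp (-1) / 4 with hℓ₀
  have hℓ₀0 : 0 < ℓ₀ := by positivity
  set m : ℕ := ⌈2 * C⌉₊ with hm
  set A₁ : ℝ := C * (Real.exp (8 * C + 4 * C * ((Nat.factorial 9 : ℝ) / 2 ^ 9)) * 2 ^ m) with hA₁
  have hA₁0 : 0 ≤ A₁ := by positivity
  set Crem : ℝ := 1 / (2 * π) * (648 * π * A₁ * ((m + 115).factorial / 2 ^ (m + 115)) +
      652800 * π * A₁ * Cinv / c ^ 2 * ((10 * (m + 120)).factorial / (3 * c / 32) ^ (10 * (m + 120))) +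
      10800 * A₁ * Cinv * ((m + 18).factorial / 2 ^ (m + 18))) with hCrem
  have hCrem0 : 0 ≤ Crem := by positivity
  set Cres1 : ℝ := C₅ * (24 * K₈ ^ 2 + 2 * K₈) + 128 * π * Real.exp (9 / 2) * K₈ ^ 3 * C with hCres1
  set Cres2 : ℝ := 256 * π * Real.exp π * Real.exp (9 / 2) * C * K₈ ^ 2 + 48 * Real.exp π * K₈ * C₅ +
      256 * π * Real.exp π * Real.exp (9 / 2) * K₈ ^ 2 * Kρ +
      128 * Real.exp π * Real.exp (9 / 2) * K₈ * Kρ +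
      32 * π * Real.exp π * Real.exp 1 * Real.exp (9 / 2) * K₈ ^ 2 * Kρ +
      8 * π * Real.exp π * Real.exp (9 / 2) * K₈ ^ 2 +
      32 * Real.exp π * Real.exp (9 / 2) * K₈ ^ 2 * Kρ with hCres2
  -- the threshold
  set Lmax : ℝ := max (max (max 3 L₅₇) (max (32 * π / c) (16 * Kρ / c)))
    (max (max (4 * Kρ + 2) (K₈ * π)) (max (4 * C₅ / (ℓ₀ * π))
      (max (32 * Real.exp (9 / 2) * Kρ / ℓ₀) (16 * (Nat.factorial 110 : ℝ) / 2 ^ 110)))) with hLmax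
  obtain ⟨D₂, hD₂⟩ := exists_nat_le_log' Lmax
  refine ⟨|Csm| + Crem + Cres1 + Cres2, max (max (max D83 D₁) (max Dsm D31)) D₂,
    fun D _ χ hD hq hp hA j hj d r hd hr hdr1 hdr2 w hw => ?_⟩
  have hM1 : max (max D83 D₁) (max Dsm D31) ≤ D := le_trans (le_max_left _ _) hD
  have hD83 : D83 ≤ D := le_trans (le_trans (le_max_left _ _) (le_max_left _ _)) hM1
  have hD₁ : D₁ ≤ D := le_trans (le_trans (le_max_right _ _) (le_max_left _ _)) hM1
  have hDsm : Dsm ≤ D := le_trans (le_trans (le_max_left _ _) (le_max_right _ _)) hM1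
  have hD31 : D31 ≤ D := le_trans (le_trans (le_max_right _ _) (le_max_right _ _)) hM1
  have hLm : Lmax ≤ Real.log D := hD₂ D (le_trans (le_max_right _ _) hD)
  set 𝓛 : ℝ := Real.log D with h𝓛def
  have h𝓛3 : 3 ≤ 𝓛 := le_trans (by simp [hLmax]) hLm
  have hL57 : L₅₇ ≤ 𝓛 := le_trans (by simp [hLmax]) hLm
  have hL32πc : 32 * π / c ≤ 𝓛 := le_trans (by simp [hLmax]) hLm
  have hL16K : 16 * Kρ / c ≤ 𝓛 := le_trans (by simp [hLmax]) hLm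
  have hLK4 : 4 * Kρ + 2 ≤ 𝓛 := le_trans (by simp [hLmax]) hLm
  have hLK₈ : K₈ * π ≤ 𝓛 := le_trans (by simp [hLmax]) hLm
  have hLC₅ : 4 * C₅ / (ℓ₀ * π) ≤ 𝓛 := le_trans (by simp [hLmax]) hLm
  have hLE' : 32 * Real.exp (9 / 2) * Kρ / ℓ₀ ≤ 𝓛 := le_trans (by simp [hLmax]) hLm
  have hbig : 16 * (Nat.factorial 110 : ℝ) / 2 ^ 110 ≤ 𝓛 := le_trans (by simp [hLmax]) hLm
  have h𝓛0 : 0 < 𝓛 := by linarith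
  have h𝓛1 : 1 ≤ 𝓛 := by linarith
  have hℓ : ell D = 𝓛 := rfl
  have hπ0 := Real.pi_pos
  have hπ3 := Real.pi_gt_three
  -- `D` itself
  have hD0 : (0 : ℝ) < D := by
    rcases lt_or_ge 0 (D : ℝ) with h | h
    · exact h
    · have : Real.log (D : ℝ) ≤ 0 := by
        have : (D : ℝ) = 0 := le_antisymm h (Nat.cast_nonneg D)
        rw [this, Real.log_zero]
      linarith
  have hDexp : (D : ℝ) = Real.exp 𝓛 := by rw [h𝓛def, Real.exp_log hD0]
  have hD3 : (3 : ℝ) ≤ D := by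
    have : Real.exp 3 ≤ Real.exp 𝓛 := Real.exp_le_exp.2 h𝓛3
    have h3 : (3 : ℝ) ≤ Real.exp 3 := by have := Real.add_one_le_exp (3 : ℝ); linarith
    linarith
  have hD2 : 2 ≤ D := by exact_mod_cast (show (2 : ℝ) ≤ D by linarith)
  have hD3n : 3 ≤ D := by exact_mod_cast hD3
  have hχ1 : χ ≠ 1 := Lemma31.ne_one_of_isPrimitive χ hD2 hp
  have hA' : ‖χ.LFunction 1‖ ≤ 1 / Real.log D ^ 2022 := le_of_lt hA
  have hA'' : ‖χ.LFunction 1‖ < (Real.log D ^ 2022)⁻¹ := by rw [← one_div]; exact hA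
  have hd0 : d ≠ 0 := by omega
  have hr0 : r ≠ 0 := by omega
  have hdr0 : d * r ≠ 0 := mul_ne_zero hd0 hr0
  -- parameters
  set α : ℝ := alpha D with hαdef
  have hαeq : α = π / 𝓛 ^ 9 := alpha_eq D
  have hα0 : 0 < α := by rw [hαeq]; positivity
  set η : ℝ := c / (8 * 𝓛) with hηdef
  have hη0 : 0 < η := by positivity
  have hη' : η ≤ 1 / 96 := by
    calc η = c / (8 * 𝓛) := hηdef
      _ ≤ (1 / 4) / (8 * 3) := by gcongr
      _ = 1 / 96 := by norm_num
  have hαη4 : α ≤ η / 4 := by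
    -- `π/𝓛⁹ ≤ c/(32𝓛)` since `32π/c ≤ 𝓛 ≤ 𝓛⁸`
    rw [hαeq, hηdef, div_div, le_div_iff₀ (by positivity), div_mul_eq_mul_div, div_le_iff₀ (by positivity)]
    have h8 : 𝓛 ≤ 𝓛 ^ 8 := le_self_pow₀ h𝓛1 (by norm_num)
    have h1 : 32 * π ≤ c * 𝓛 := by rw [div_le_iff₀ hc] at hL32πc; linarith
    calc π * (8 * 𝓛 * 4) = (32 * π) * 𝓛 := by ring
      _ ≤ (c * 𝓛) * 𝓛 ^ 8 := by gcongr
      _ = c * 𝓛 ^ 9 := by ring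
  have hαη : α ≤ η := by linarith
  have hη40 : η ≤ 1 / 40 := by linarith
  have hα5 : α ≤ 1 / 5 := by linarith
  -- the exceptional zero and the zero-free package
  obtain ⟨ρ, hρ1, hρK, hLρ, hL'ρ, hzfp⟩ := hpack D χ hD₁ hχ1 hA''
  have hρpos : 0 ≤ 1 - ρ := by linarith
  have hKρ2 : 1 - ρ ≤ Kρ / 𝓛 ^ 2 := by
    refine hρK.trans ?_
    rw [← div_eq_mul_inv]
    exact div_le_div_of_nonneg_left hKρ.le (by positivity) (pow_le_pow_right₀ h𝓛1 (by norm_num))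
  have hKρ10 : 1 - ρ ≤ Kρ / 𝓛 ^ 10 := by
    refine hρK.trans ?_
    rw [← div_eq_mul_inv]
    exact div_le_div_of_nonneg_left hKρ.le (by positivity) (pow_le_pow_right₀ h𝓛1 (by norm_num))
  have hρη : 1 - η / 2 ≤ ρ := by
    have h1 : Kρ / 𝓛 ^ 2 ≤ c / (16 * 𝓛) := by
      rw [div_le_div_iff₀ (by positivity) (by positivity)]
      have h16 : 16 * Kρ ≤ c * 𝓛 := by rw [div_le_iff₀ hc] at hL16K; linarith
      calc Kρ * (16 * 𝓛) = (16 * Kρ) * 𝓛 := by ring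
        _ ≤ (c * 𝓛) * 𝓛 := by gcongr
        _ = c * 𝓛 ^ 2 := by ring
    rw [hηdef]
    have : c / (8 * 𝓛) / 2 = c / (16 * 𝓛) := by ring
    linarith
  have hρα4 : 1 - ρ ≤ α / 4 := by
    -- `Kρ/𝓛¹⁰ ≤ π/(4𝓛⁹)` since `4Kρ ≤ π𝓛`
    refine hKρ10.trans ?_
    rw [hαeq, div_div, div_le_div_iff₀ (by positivity) (by positivity)]
    have h3 : Kρ * 4 ≤ π * 𝓛 := by nlinarith
    calc Kρ * (𝓛 ^ 9 * 4) = (Kρ * 4) * 𝓛 ^ 9 := by ring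
      _ ≤ (π * 𝓛) * 𝓛 ^ 9 := by gcongr
      _ = π * 𝓛 ^ 10 := by ring
  have hρα : 1 - alpha D / 2 < ρ := by rw [← hαdef]; linarith
  have hρL : 1 - ρ ≤ 1 / (4 * Real.log D) := by
    refine hKρ2.trans ?_
    rw [← h𝓛def, div_le_div_iff₀ (by positivity) (by positivity)]
    calc Kρ * (4 * 𝓛) = (4 * Kρ) * 𝓛 := by ring
      _ ≤ 𝓛 * 𝓛 := by gcongr; linarith
      _ = 1 * 𝓛 ^ 2 := by ring
  have hρE : 8 * Real.exp (9 / 2) * (1 + Real.log D) * Real.log D ^ 2 * (1 - ρ) ≤ ℓ₀ / 2 := by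
    rw [← h𝓛def]
    have hKρ4 : 1 - ρ ≤ Kρ / 𝓛 ^ 4 := by
      refine hρK.trans ?_
      rw [← div_eq_mul_inv]
      exact div_le_div_of_nonneg_left hKρ.le (by positivity) (pow_le_pow_right₀ h𝓛1 (by norm_num))
    have h1 : 32 * Real.exp (9 / 2) * Kρ ≤ ℓ₀ * 𝓛 := by
      rw [div_le_iff₀ hℓ₀0] at hLE'; linarith
    calc 8 * Real.exp (9 / 2) * (1 + 𝓛) * 𝓛 ^ 2 * (1 - ρ)
        ≤ 8 * Real.exp (9 / 2) * (1 + 𝓛) * 𝓛 ^ 2 * (Kρ / 𝓛 ^ 4) := by gcongr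
      _ = (32 * Real.exp (9 / 2) * Kρ) * ((1 + 𝓛) / (4 * 𝓛 ^ 2)) := by field_simp; ring
      _ ≤ (ℓ₀ * 𝓛) * ((1 + 𝓛) / (4 * 𝓛 ^ 2)) := by gcongr
      _ = ℓ₀ / 2 * ((1 + 𝓛) / (2 * 𝓛)) := by field_simp; ring
      _ ≤ ℓ₀ / 2 * 1 := by
          gcongr
          rw [div_le_one (by positivity)]; linarith
      _ = ℓ₀ / 2 := mul_one _
  -- the `1/L` package on `Re s ≥ 1 − 2η`, `|Im s| ≤ D + 1`
  have hlog5 : Real.log ((D : ℝ) + 5) ≤ 2 * 𝓛 := by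
    have h1 : (D : ℝ) + 5 ≤ (D : ℝ) ^ 2 := by
      have h0 : (0 : ℝ) ≤ ((D : ℝ) - 3) * ((D : ℝ) + 2) := mul_nonneg (by linarith) (by linarith)
      have e : ((D : ℝ) - 3) * ((D : ℝ) + 2) = (D : ℝ) ^ 2 - (D : ℝ) - 6 := by ring
      rw [e] at h0; linarith
    calc Real.log ((D : ℝ) + 5) ≤ Real.log ((D : ℝ) ^ 2) := Real.log_le_log (by positivity) h1
      _ = 2 * 𝓛 := by rw [Real.log_pow, h𝓛def]; ring
  have hpk : ∀ s : ℂ, 1 - 2 * η ≤ s.re → |s.im| ≤ Real.exp 𝓛 + 1 → s ≠ (ρ : ℂ) →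
      χ.LFunction s ≠ 0 ∧ ‖(χ.LFunction s)⁻¹‖ ≤ 3 * Cinv * 𝓛 * (1 + ‖s - ρ‖⁻¹) := by
    intro s hs him hne
    rw [← hDexp] at him
    have hls : Real.log (|s.im| + 4) ≤ 2 * 𝓛 :=
      (Real.log_le_log (by positivity) (by linarith)).trans hlog5
    have hl0 : 0 ≤ Real.log (|s.im| + 4) := Real.log_nonneg (by linarith [abs_nonneg s.im])
    have hsum0 : 0 < Real.log D + Real.log (|s.im| + 4) := by rw [← h𝓛def]; linarith
    have hre : 1 - c / (Real.log D + Real.log (|s.im| + 4)) ≤ s.re := by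
      have h1 : 2 * η ≤ c / (Real.log D + Real.log (|s.im| + 4)) := by
        rw [hηdef, le_div_iff₀ hsum0, ← h𝓛def]
        have : 2 * (c / (8 * 𝓛)) * (𝓛 + Real.log (|s.im| + 4)) ≤ 2 * (c / (8 * 𝓛)) * (3 * 𝓛) := by
          gcongr; linarith
        have e : 2 * (c / (8 * 𝓛)) * (3 * 𝓛) = 3 * c / 4 := by field_simp; ring
        linarith
      linarith
    obtain ⟨hne0, hb⟩ := hzfp s hre hne
    refine ⟨hne0, hb.trans ?_⟩
    have : Cinv * (Real.log D + Real.log (|s.im| + 4)) ≤ 3 * Cinv * 𝓛 := by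
      rw [← h𝓛def]
      calc Cinv * (𝓛 + Real.log (|s.im| + 4)) ≤ Cinv * (𝓛 + 2 * 𝓛) := by gcongr
        _ = 3 * Cinv * 𝓛 := by ring
    exact mul_le_mul_of_nonneg_right this (by positivity)
  -- the continuation `U` of Lemma 8.3 (relative form)
  have hdrPT : ((d * r : ℕ) : ℝ) < bigP D / bigT D ^ 2 := lt_of_lt_of_le hdr2 (P2_le_bigP_div D)
  obtain ⟨U, hUd, hU1, hU2, hU3⟩ := h83 D χ hD83 hq hp hA j hj d r hd hr hdrPT
  -- `U` on `Re w ≥ 1 − η`: `‖U‖ ≤ A₁𝓛^m`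
  set MU : ℝ := C * Real.exp (2 * C * (Real.log (2 * Real.log D) + 4) +
    4 * C * Real.log D ^ 9 / (D : ℝ) ^ 2) with hMUdef
  have hMU0 : 0 ≤ MU := by positivity
  have hlogdr : Real.log ((d * r : ℕ) : ℝ) ≤ Real.log D ^ 9 := by
    have hT2 : 1 ≤ bigT D ^ 2 := one_le_pow₀ (by rw [bigT]; exact Real.one_le_exp_iff.2 (by positivity))
    have h1 : ((d * r : ℕ) : ℝ) ≤ bigP D := hdrPT.le.trans (div_le_self (bigP_pos D).le hT2)
    have h2 : (0 : ℝ) < ((d * r : ℕ) : ℝ) := by exact_mod_cast Nat.pos_of_ne_zero hdr0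
    calc Real.log ((d * r : ℕ) : ℝ) ≤ Real.log (bigP D) := Real.log_le_log h2 h1
      _ = Real.log D ^ 9 := by rw [bigP, Real.log_exp, ell]
  have hU : ∀ w : ℂ, 1 - η ≤ w.re → ‖U w‖ ≤ MU := by
    intro w hw
    have hw9 : 9 / 10 < w.re := by linarith
    have h1 := hU2 w hw9
    have hηL : 2 * η * Real.log D ≤ 1 / 4 := by
      have e : 2 * (c / (8 * 𝓛)) * 𝓛 = c / 4 := by field_simp; ring
      rw [hηdef, ← h𝓛def, e]
      linarith
    have hprod := prod_primeFactors_le (D := D) (n := d * r) (by rw [← h𝓛def]; linarith) hdr0 hlogdr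
      hC0 hη0.le hηL (σ := w.re) hw
    calc ‖U w‖ ≤ C₈₃ * ∏ q ∈ (d * r).primeFactors, (1 + C₈₃ * (q : ℝ) ^ (-w.re)) := h1
      _ ≤ |C₈₃ * ∏ q ∈ (d * r).primeFactors, (1 + C₈₃ * (q : ℝ) ^ (-w.re))| := le_abs_self _
      _ = C * ∏ q ∈ (d * r).primeFactors, |1 + C₈₃ * (q : ℝ) ^ (-w.re)| := by
          rw [abs_mul, Finset.abs_prod]
      _ ≤ C * ∏ q ∈ (d * r).primeFactors, (1 + C * (q : ℝ) ^ (-w.re)) := by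
          refine mul_le_mul_of_nonneg_left ?_ hC0
          refine Finset.prod_le_prod (fun _ _ => abs_nonneg _) fun q _ => ?_
          calc |1 + C₈₃ * (q : ℝ) ^ (-w.re)| ≤ |(1 : ℝ)| + |C₈₃ * (q : ℝ) ^ (-w.re)| := abs_add_le _ _
            _ = 1 + C * (q : ℝ) ^ (-w.re) := by
                rw [abs_one, abs_mul, abs_of_nonneg (Real.rpow_nonneg (Nat.cast_nonneg q) _)]
      _ ≤ MU := mul_le_mul_of_nonneg_left hprod hC0
  have hMUle : MU ≤ A₁ * 𝓛 ^ m := by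
    have h := frakM_le (D := D) hC0 (by rw [← h𝓛def]; exact h𝓛1)
    rw [hMUdef, hA₁, h𝓛def]
    calc C * Real.exp (2 * C * (Real.log (2 * Real.log D) + 4) + 4 * C * Real.log D ^ 9 / (D : ℝ) ^ 2)
        ≤ C * (Real.exp (8 * C + 4 * C * ((Nat.factorial 9 : ℝ) / 2 ^ 9)) * 2 ^ ⌈2 * C⌉₊ *
            Real.log D ^ ⌈2 * C⌉₊) := mul_le_mul_of_nonneg_left h hC0
      _ = _ := by rw [hm]; ring
  -- `U − Π` in the relative form with `C = |C₈₃|`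
  set hatPi : ℝ := ∏ q ∈ (d * r).primeFactors, (1 - (q : ℝ)⁻¹)⁻¹ with hhatPi
  have hPi1 : 1 ≤ hatPi :=
    Literature.NumberTheory.Sieve.GreenTao2008.GYCorr.one_le_prod_one_sub_inv_inv (d * r)
  have hU3' : ∀ s : ℂ, ‖s - 1‖ ≤ 5 * alpha D → ‖U s - PiW χ d r‖ ≤ C * (ell D ^ 8)⁻¹ * hatPi := by
    intro s hs
    refine (hU3 s hs).trans ?_
    gcongr
    exact le_abs_self _
  -- `L(s,χ)` on `Re s ≥ 1 − η`, `|s| ≤ D + 4`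
  have hBL : ∀ s : ℂ, 1 - η ≤ s.re → ‖s‖ ≤ Real.exp 𝓛 + 4 → ‖χ.LFunction s‖ ≤ 2 * (4 + 3 * 𝓛) := by
    intro s hs hsn
    rw [← hDexp] at hsn
    have hls : Real.log (‖s‖ + 1) ≤ 2 * 𝓛 :=
      (Real.log_le_log (by positivity) (by linarith)).trans hlog5
    have hl0 : 0 ≤ Real.log (‖s‖ + 1) := Real.log_nonneg (by linarith [norm_nonneg s])
    have h := norm_LFunction_le_near_one χ hχ1 (η := η) (by linarith) hs (by
      rw [← h𝓛def]
      calc η * (𝓛 + Real.log (‖s‖ + 1)) ≤ η * (𝓛 + 2 * 𝓛) := by gcongr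
        _ = 3 * c / 8 := by rw [hηdef]; field_simp; ring
        _ ≤ 1 / 8 := by linarith)
    rw [← h𝓛def] at h
    linarith
  -- `|L′(1,χ)| ≥ ℓ₀`
  have hℓlow : ℓ₀ ≤ ‖deriv χ.LFunction 1‖ := by
    have h := h57 D χ hp hq.sq_eq_one hL57 hA'
    have hφpos : (0 : ℝ) < Nat.totient D := by exact_mod_cast Nat.totient_pos.mpr (by omega)
    have hφle : (Nat.totient D : ℝ) ≤ D := by exact_mod_cast Nat.totient_le D
    have hrat : (1 : ℝ) ≤ (D : ℝ) / Nat.totient D := by rw [le_div_iff₀ hφpos]; linarith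
    calc ℓ₀ = Real.exp (-1) / 4 * 1 := (mul_one _).symm
      _ ≤ Real.exp (-1) / 4 * ((D : ℝ) / Nat.totient D) := by gcongr
      _ ≤ (deriv χ.LFunction 1).re := h
      _ ≤ ‖deriv χ.LFunction 1‖ := Complex.re_le_norm _
  -- Lemma 5.8's range and the `E ≤ ℓ₀α/4` condition
  have hK₈L : K₈ * π ≤ Real.log D ^ 8 := hLK₈.trans (le_self_pow₀ h𝓛1 (by norm_num))
  have hE : C₅ / Real.log D ^ 15 ≤ ℓ₀ * alpha D / 4 := by
    rw [← hαdef, hαeq, ← h𝓛def]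
    rw [div_le_iff₀ (by positivity)]
    have h1 : 4 * C₅ ≤ ℓ₀ * π * 𝓛 := by rw [div_le_iff₀ (by positivity)] at hLC₅; linarith
    have h2 : 𝓛 ^ 15 = 𝓛 ^ 9 * 𝓛 ^ 6 := by ring
    have h3 : 𝓛 ≤ 𝓛 ^ 6 := le_self_pow₀ h𝓛1 (by norm_num)
    have h4 : ℓ₀ * π * 𝓛 ≤ ℓ₀ * π * 𝓛 ^ 6 := mul_le_mul_of_nonneg_left h3 (by positivity)
    calc C₅ = 4 * C₅ / 4 := by ring
      _ ≤ ℓ₀ * π * 𝓛 ^ 6 / 4 := by linarith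
      _ = ℓ₀ * (π / 𝓛 ^ 9) / 4 * 𝓛 ^ 15 := by rw [h2]; field_simp
  -- the point `Y = P″₂/(dr)` and `Λ = 𝓛¹⁰⁰`
  set Y : ℝ := P2pp D / ((d * r : ℕ) : ℝ) with hYdef
  obtain ⟨hYT, hYP⟩ := window_point_bounds (by rw [hℓ]; exact h𝓛1) hdr1 hdr2
  have hT1 : 1 ≤ bigT D := by rw [bigT]; exact Real.one_le_exp (by positivity)
  have hY1 : Real.exp (𝓛 ^ (1.1 : ℝ)) ≤ Y := by
    calc Real.exp (𝓛 ^ (1.1 : ℝ)) = bigT D := by rw [bigT, hℓ]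
      _ ≤ bigT D ^ 10 := le_self_pow₀ hT1 (by norm_num)
      _ ≤ Y := hYT
  have hY2 : Y ≤ Real.exp (𝓛 ^ 9) := by rw [← hℓ, ← bigP]; exact hYP
  have hY1' : 1 ≤ Y := le_trans hT1 ((le_self_pow₀ hT1 (by norm_num)).trans hYT)
  have hY0 : 0 < Y := by linarith
  have hlogY : Real.log Y ≤ 𝓛 ^ 9 := by
    have := Real.log_le_log hY0 hY2; rwa [Real.log_exp] at this
  have hlogY0 : 0 ≤ Real.log Y := Real.log_nonneg hY1'
  have hαY : alpha D * Real.log Y ≤ π := by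
    rw [← hαdef, hαeq]
    calc π / 𝓛 ^ 9 * Real.log Y ≤ π / 𝓛 ^ 9 * 𝓛 ^ 9 := by gcongr
      _ = π := by field_simp
  have hρY : (1 - ρ) * Real.log Y ≤ 1 := by
    calc (1 - ρ) * Real.log Y ≤ Kρ / 𝓛 ^ 10 * 𝓛 ^ 9 := by gcongr
      _ = Kρ / 𝓛 := by field_simp
      _ ≤ 1 := by rw [div_le_one h𝓛0]; linarith
  set Λ : ℝ := 𝓛 ^ 100 with hΛdef
  have hΛ1 : 1 ≤ Λ := one_le_pow₀ h𝓛1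
  have hΛ0 : 0 < Λ := by positivity
  have hΛell : ell D ^ 100 ≤ Λ := by rw [hℓ]
  -- (1) the smoothing step
  have hS := hsm D χ hDsm hq hp j d r hd hr hdr1 hdr2 w hw Λ hΛell
  -- (2) the contour step: `β_μ := β₆ − i·Im w`, `θ := −Re w`
  set βμ : ℂ := beta6 D - (w.im : ℂ) * I with hβμdef
  set θ : ℝ := -w.re with hθdef
  set βa : ℂ := betaJ c' D (j + 1) with hβadef
  set βb : ℂ := betaJ c' D (j + 2) with hβbdef
  have hwre : |w.re| ≤ α := by rw [← hw]; exact Complex.abs_re_le_norm w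
  have hwim : |w.im| ≤ α := by rw [← hw]; exact Complex.abs_im_le_norm w
  have hβμre : βμ.re = 0 := by simp [hβμdef, beta6]
  have hβμim_eq : βμ.im = 3 * α / 2 - w.im := by
    simp [hβμdef, beta6, hαdef]; try ring
  have hβμim : 0 < βμ.im := by
    rw [hβμim_eq]; linarith [(abs_le.mp hwim).2]
  have hβμn : ‖βμ‖ ≤ 1 / 2 := by
    have h1 : ‖βμ‖ ≤ |βμ.re| + |βμ.im| := Complex.norm_le_abs_re_add_abs_im βμ
    rw [hβμre, abs_zero, zero_add, hβμim_eq] at h1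
    have h2 : |3 * α / 2 - w.im| ≤ 3 * α / 2 + α := by
      rw [abs_le]; constructor <;> linarith [(abs_le.mp hwim).1, (abs_le.mp hwim).2]
    linarith
  have hθ : |θ| ≤ η / 4 := by rw [hθdef, abs_neg]; exact hwre.trans hαη4
  have hβare : βa.re = 0 := betaJ_re c' D _
  have hβbre : βb.re = 0 := betaJ_re c' D _
  have hαℓ : α * ell D ≤ 1 := alpha_mul_ell_le_one (by rw [hℓ]; linarith)
  have hβn : ∀ i : ℕ, ‖betaJ c' D i‖ ≤ 1 := by
    intro i
    have h := norm_betaJ_le c' D i hα0.le (by rw [hℓ]; linarith : 0 ≤ ell D)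
    refine h.trans ?_
    have h1 : 5 * |c'| * alpha D * ell D ≤ 5 * |c'| := by
      calc 5 * |c'| * alpha D * ell D = 5 * |c'| * (alpha D * ell D) := by ring
        _ ≤ 5 * |c'| * 1 := by gcongr
        _ = 5 * |c'| := mul_one _
    have hKα : K₈ * α ≤ 1 := by
      rw [hαeq]
      have h9 : 𝓛 ^ 9 = 𝓛 ^ 8 * 𝓛 := by ring
      rw [mul_div_assoc', div_le_one (by positivity), h9]
      calc K₈ * π ≤ 𝓛 := hLK₈
        _ = 1 * 𝓛 := (one_mul _).symm
        _ ≤ 𝓛 ^ 8 * 𝓛 := by gcongr; exact one_le_pow₀ h𝓛1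
    rw [← hαdef] at h1 ⊢
    have h2 : 3 * α * (1 + 5 * |c'| * α * ell D) ≤ 3 * α * (1 + 5 * |c'|) := by gcongr
    have h3 : K₈ * α - 3 * α * (1 + 5 * |c'|) = 4 * α := by rw [hK₈]; ring
    linarith
  -- `T′ := D = e^{𝓛}`
  have hT2 : (2 : ℝ) ≤ Real.exp 𝓛 := by rw [← hDexp]; linarith
  have hTβ : βμ.im < Real.exp 𝓛 := by
    rw [hβμim_eq]; linarith [(abs_le.mp hwim).1]
  -- the integrand `Φ` and the coefficients `f`
  set Φ : ℂ → ℂ := fun u => U (1 - βμ + u) * χ.LFunction (1 - βμ + u + βa) *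
    χ.LFunction (1 - βμ + u + βb) / χ.LFunction (1 - βμ + u) with hΦdef
  have hΦ : ∀ u, Φ u = U (1 - βμ + u) * χ.LFunction (1 - βμ + u + βa) *
      χ.LFunction (1 - βμ + u + βb) / χ.LFunction (1 - βμ + u) := fun u => rfl
  set f : ℕ → ℂ := fun n => χ (n : ZMod D) * xiZero c' D j n d r with hfdef
  have hfs : LSeriesSummable f (2 - βμ) :=
    Lemma83.lseriesSummable_chi_mul_xiZero c' D j χ hd0 hr0 (by simp [hβμre])
  have hfΦ : ∀ t : ℝ, LSeries f (1 - βμ + (((1 : ℝ) : ℂ) + t * I)) = Φ (((1 : ℝ) : ℂ) + t * I) := by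
    intro t
    set wpt : ℂ := 1 - βμ + (((1 : ℝ) : ℂ) + t * I) with hwpt
    have hwre' : wpt.re = 2 := by simp [hwpt, hβμre]; norm_num
    have hw1 : 1 < wpt.re := by rw [hwre']; norm_num
    have hne : ∀ β : ℂ, β.re = 0 → χ.LFunction (wpt + β) ≠ 0 := fun β hβ =>
      (inv_LFunction_le_right χ (a := 1) (by norm_num) (s := wpt + β)
        (by simp [hwre', hβ]; norm_num)).1
    have hne0 : χ.LFunction wpt ≠ 0 := by
      have := hne 0 (by simp); rwa [add_zero] at this
    have hna := hne βa hβare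
    have hnb := hne βb hβbre
    rw [hΦ, ← hwpt, hU1 wpt hw1, xiSeries_eq_LSeries, ← hfdef]
    field_simp
  have hF3 := smoothedSeries_sub_residues_le χ U Φ βμ βa βb (ρ := ρ) (η := η) (T' := Real.exp 𝓛)
    (MU := MU) (BL := 2 * (4 + 3 * 𝓛)) (Minv := 3 * Cinv * 𝓛) hχ1 (Λ := Λ) (Y := Y) (θ := θ)
    hΛ0 hY0 hUd hβμre hβμim hβμn hβare (hβn _) hβbre (hβn _) hΦ hη0 hη40 hθ hT2 hTβ hMU0 hU
    (by positivity) hBL (by positivity) hpk hρ1 hρη hLρ hL'ρ f hfs hfΦ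
  -- (3) identify the pieces
  have hs0eq : 1 - βμ - (θ : ℂ) = 1 - beta6 D + w := by
    rw [hβμdef, hθdef]
    have := Complex.re_add_im w
    push_cast
    linear_combination this
  have hτeq : (((ρ - 1 : ℝ) : ℂ) + βμ) + (θ : ℂ) = ((ρ - 1 : ℝ) : ℂ) - (w - beta6 D) := by
    rw [hβμdef, hθdef]
    have := Complex.re_add_im w
    push_cast
    linear_combination -this
  have hΦ0 : Φ (-(θ : ℂ)) = U (1 - beta6 D + w) * χ.LFunction (1 - beta6 D + w + βa) *
      χ.LFunction (1 - beta6 D + w + βb) / χ.LFunction (1 - beta6 D + w) := by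
    rw [hΦ, ← sub_eq_add_neg, hs0eq]
  -- the smoothed series in the two spellings
  have hseries : (∑' n : ℕ, LSeries.term f (1 - βμ - θ) n * (gWeight Λ (Y / n) : ℂ)) =
      ∑' l : ℕ, χ (l : ZMod D) * xiZero c' D j l d r / (l : ℂ) ^ (1 - beta6 D + w) *
        (gWeight Λ (P2pp D / ((d * r : ℕ) : ℝ) / l) : ℂ) := by
    rw [hs0eq]
    refine tsum_congr fun n => ?_
    rcases Nat.eq_zero_or_pos n with rfl | hn
    · simp [LSeries.term_zero, Lemma83.xiZero_apply_zero]
    · rw [LSeries.term_of_ne_zero hn.ne', hfdef]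
  -- (4) the residues against the model
  have hR1 := norm_resOne_sub_model_le χ c' hp h𝓛3 hA' j hd0 hr0 U hC0 (le_refl K₈) hK₈L hℓ₀0
    hℓlow hE hU3' hw
  have hR2 := norm_resTwo_sub_model_le χ c' hp h𝓛3 hA' j hd0 hr0 U hC0 (le_refl K₈) hK₈L hℓ₀0
    hℓlow hE hU3' hρ1.le (by rw [← hαdef]; exact hρα4) hρL hρE hY1' hαY hρY hΛ1 hw
  -- (5) the model is `L′(1,χ)Π·circ030` (u031)
  have h31' := h31 D χ hD31 hq hp j hj d r hd hr hdr1 hdr2 w hw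
  obtain ⟨hs0, -⟩ := pole_aux hD3n hw
  have hint : ∫ y in (1 : ℝ)..Y, (y : ℂ) ^ (beta6 D - w - 1) =
      ((Y : ℂ) ^ (-(w - beta6 D)) - 1) / (-(w - beta6 D)) := by
    have hr : beta6 D - w - 1 ≠ -1 := by
      intro h; apply hs0; linear_combination -h
    rw [integral_cpow (Or.inr ⟨hr, by
      rw [Set.uIcc_of_le hY1']; intro h; exact absurd h.1 (by norm_num)⟩)]
    have e1 : beta6 D - w - 1 + 1 = -(w - beta6 D) := by ring
    rw [e1, Complex.ofReal_one, Complex.one_cpow]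
  have hmodel : deriv χ.LFunction 1 * PiW χ d r *
        ((w - beta6 D + βa) * (w - beta6 D + βb) / (w - beta6 D)) +
      deriv χ.LFunction 1 * PiW χ d r * (βa * βb * ((Y : ℂ) ^ (-(w - beta6 D)) / (-(w - beta6 D)))) =
      deriv χ.LFunction 1 * PiW χ d r * circ030 c' D j d r w := by
    rw [h31', hint, ← mul_add, model_identity hs0, hβadef, hβbdef]
  -- (6) sizes of the four error pieces
  have hRem := Lemma84.remainder_le (m := m) (MU := MU) (Y := Y) (θ := θ) h𝓛3 hc hc4 hCinv hA₁0 hMU0 hMUle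
    hY1 hY2 (by rw [hηdef] at hθ; exact hθ) hbig
  have hRes1 := Lemma84.resOne_le (C := C) (K := K₈) (C₅ := C₅) h𝓛1 hPi1 hC0 hK₈0
  have hRes2 := Lemma84.resTwo_le (C := C) (K := K₈) (C₅ := C₅) (Kρ := Kρ) (δ := 1 - ρ) (logY := Real.log Y)
    (α := α) (Λ := Λ) h𝓛1 hPi1 hC0 hK₈0 hKρ.le hρpos hρK hlogY0 hlogY hαeq rfl
  have habsρ : |ρ - 1| = 1 - ρ := by rw [abs_of_nonpos (by linarith)]; ring
  -- align the four estimates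
  rw [hseries, hΦ0, hτeq] at hF3
  rw [← hηdef, ← hΛdef] at hRem
  have hF3' : _ ≤ Crem * (𝓛 ^ 15)⁻¹ := hF3.trans hRem
  have hR1' : _ ≤ Cres1 * (𝓛 ^ 15)⁻¹ * hatPi ^ 2 := hR1.trans (by
    rw [← h𝓛def, hℓ, ← hαdef, hαeq, ← hhatPi, ← hC₅]; exact hRes1)
  have hR2' : _ ≤ Cres2 * (𝓛 ^ 15)⁻¹ * hatPi ^ 2 := hR2.trans (by
    rw [← h𝓛def, hℓ, ← hαdef, ← hhatPi, ← hC₅, habsρ]; exact hRes2)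
  have hS' : ‖innerSumLow c' χ j d r w -
      ∑' l : ℕ, χ (l : ZMod D) * xiZero c' D j l d r / (l : ℂ) ^ (1 - beta6 D + w) *
        (gWeight Λ (P2pp D / ((d * r : ℕ) : ℝ) / l) : ℂ)‖ ≤ |Csm| * (𝓛 ^ 15)⁻¹ * hatPi ^ 2 := by
    refine hS.trans ?_
    rw [hℓ]
    have h0 : 0 ≤ (𝓛 ^ 15)⁻¹ := by positivity
    calc Csm * (𝓛 ^ 15)⁻¹ ≤ |Csm| * (𝓛 ^ 15)⁻¹ := mul_le_mul_of_nonneg_right (le_abs_self _) h0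
      _ = |Csm| * (𝓛 ^ 15)⁻¹ * 1 := (mul_one _).symm
      _ ≤ |Csm| * (𝓛 ^ 15)⁻¹ * hatPi ^ 2 := by gcongr; exact one_le_pow₀ hPi1
  have hRem' : Crem * (𝓛 ^ 15)⁻¹ ≤ Crem * (𝓛 ^ 15)⁻¹ * hatPi ^ 2 := by
    calc Crem * (𝓛 ^ 15)⁻¹ = Crem * (𝓛 ^ 15)⁻¹ * 1 := (mul_one _).symm
      _ ≤ Crem * (𝓛 ^ 15)⁻¹ * hatPi ^ 2 := by gcongr; exact one_le_pow₀ hPi1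
  -- name the pieces and conclude
  set S1 : ℂ := ∑' l : ℕ, χ (l : ZMod D) * xiZero c' D j l d r / (l : ℂ) ^ (1 - beta6 D + w) *
    (gWeight Λ (P2pp D / ((d * r : ℕ) : ℝ) / l) : ℂ) with hS1
  set R1 : ℂ := U (1 - beta6 D + w) * χ.LFunction (1 - beta6 D + w + βa) *
    χ.LFunction (1 - beta6 D + w + βb) / χ.LFunction (1 - beta6 D + w) with hR1def
  set R2 : ℂ := U ρ * χ.LFunction (ρ + βa) * χ.LFunction (ρ + βb) / deriv χ.LFunction ρ *
    ((Y : ℂ) ^ (((ρ - 1 : ℝ) : ℂ) - (w - beta6 D)) *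
      omega1 Λ (((ρ - 1 : ℝ) : ℂ) - (w - beta6 D)) / (((ρ - 1 : ℝ) : ℂ) - (w - beta6 D))) with hR2def
  set M1 : ℂ := deriv χ.LFunction 1 * PiW χ d r *
    ((w - beta6 D + βa) * (w - beta6 D + βb) / (w - beta6 D)) with hM1
  set M2 : ℂ := deriv χ.LFunction 1 * PiW χ d r *
    (βa * βb * ((Y : ℂ) ^ (-(w - beta6 D)) / (-(w - beta6 D)))) with hM2
  rw [← hmodel, hℓ]
  have halg : innerSumLow c' χ j d r w - (M1 + M2) =
      (innerSumLow c' χ j d r w - S1) + (S1 - (R1 + R2)) + ((R1 - M1) + (R2 - M2)) := by ring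
  rw [halg]
  clear_value Crem Cres1 Cres2
  calc ‖(innerSumLow c' χ j d r w - S1) + (S1 - (R1 + R2)) + ((R1 - M1) + (R2 - M2))‖
      ≤ ‖innerSumLow c' χ j d r w - S1‖ + ‖S1 - (R1 + R2)‖ + (‖R1 - M1‖ + ‖R2 - M2‖) := by
        refine (norm_add_le _ _).trans (add_le_add (norm_add_le _ _) (norm_add_le _ _))
    _ ≤ |Csm| * (𝓛 ^ 15)⁻¹ * hatPi ^ 2 + Crem * (𝓛 ^ 15)⁻¹ * hatPi ^ 2 +
        (Cres1 * (𝓛 ^ 15)⁻¹ * hatPi ^ 2 + Cres2 * (𝓛 ^ 15)⁻¹ * hatPi ^ 2) :=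
        add_le_add (add_le_add hS' (hF3'.trans hRem')) (add_le_add hR1' hR2')
    _ = (|Csm| + Crem + Cres1 + Cres2) * (𝓛 ^ 15)⁻¹ * hatPi ^ 2 := by ring

end Literature.NumberTheory.LFunctions.Zhang2022.Typed.Sec12B
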